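import Literature.AnabelianGeometry.SemiGraphs.PSCTwoComponentUnmarkedEdges
import HarnessLib

/-!
# [CombGC] Prop. 1.2 (i) at IRREDUCIBLE ONE-NODAL data (one vertex with a loop): the edge-like case

Mochizuki, *A combinatorial version of the Grothendieck conjecture* [CombGC] §1, Prop. 1.2 (i) p. 8
[cite: MochizukiCombGC2007, Prop 1.2(i) p.8].  PROOF-ONLY file (abc-iut-f-164 gen 2; row F-0459
`PSCDatum.OpenInterDeterminesComponentHolds`).  After the two-component one-node shapes
(`PSCTwoComponentAffine*.lean`, `PSCTwoComponentUnmarked*.lean`: the boundary strata `Δ_h` of `M̄_{g,r}`)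
this file treats the other codimension-one degeneration, the stratum `Δ_irr`: the DATA OF IRREDUCIBLE
ONE-NODAL SHAPE are what [CombGC] Def. 1.1 extracts from an irreducible pointed stable curve with exactly
ONE node (geometric genus `g − 1`, `r` marked points; dual semi-graph = one vertex with a LOOP and `r` open
edges).  Along the specialisation isomorphism `Π` is a pro-`Σ` completion `ι : Γ_{g,r} → Π` of the
smoothing, the node group is `Π_ν = closure ι⟨b_0⟩` (the vanishing cycle: the non-separating simple closed
curve `b_0`), the cusp groups are `closure ι⟨c_j⟩`, and the single vertex group is
`closure ι⟨b_0, a_0 b_0 a_0⁻¹, a_i, b_i (i ≥ 1), c_j⟩` (the surface cut open along `b_0`; `a_0` is the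
stable letter) — hypotheses `hE`, `hC` (the vertex group does not enter Prop. 1.2 (i) at one vertex).

## The argument (edge-like case; the verticial and unramified cases are trivial at one vertex)

* node vs cusp `c_j`: the HANDLE character `b_0 ↦ 1` (every other generator `↦ 0`) kills every cusp group
  and is `1` on `ι(b_0)` — abelian, always available;
* cusp `c_j` vs node: the two-cusp character `c_j ↦ 1, c_k ↦ −1` (`b_0 ↦ 0`) when `r ≥ 2`; for `r = 1`
  (then `g ≥ 2`) the Heisenberg quotient `(a_1, b_1) ↦ (X, Y)`, `c_0 ↦ Z⁻¹`, `a_0, b_0 ↦ 1`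
  (`ProSigmaHeisenbergSeparation.lean`; engine `not_isOpen_inf_subgroupOf_of_heisenberg` below, public);
* cusp vs cusp: malnormality of cusp inertia (abc-iut-L3-t4).
Hypothesis `2 ≤ g ∨ 2 ≤ r`: the one-pointed nodal cubic (`Γ_{1,1}`, where `c_0 = [a_0, b_0]` lies in the
normal closure of the node loop `b_0`, so no quotient KILLING `b_0` sees `c_0`) needs a conjugacy — not
kernel — version of the engine and is not covered.  Results: `edgeLikeOpenInterDeterminesEdge_of_irreducibleNodal`,
`openInterDeterminesComponent_of_irreducibleNodal`.  Shape instances are consistency evidence for the typed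
schema, not the printed theorem for all pointed stable curves; nothing here takes a side on [IUTchIII]
Cor. 3.12.
-/

noncomputable section

namespace Literature.AnabelianGeometry.SemiGraphs

open scoped Pointwise
open Literature.GroupTheory.CombinatorialGroupTheory
open SemiGraphOfAnabelioids (IsProSigmaCompletion)
open Multiplicative

universe u

namespace PSCDatum

open TwoComponentAffine

variable {P : Type u} [Group P] [TopologicalSpace P] [IsTopologicalGroup P]
variable [CompactSpace P] [T2Space P] [TotallyDisconnectedSpace P] {Sigma : Set ℕ} {g r : ℕ}

omit [CompactSpace P] [T2Space P] [TotallyDisconnectedSpace P] in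
/-- A conjugate of a closed subgroup is closed (private copy of abc-iut-w5-d183's `isClosed_conj_smul`).
[cite: MochizukiCombGC2007, Def 1.1(ii) p.6] -/
private theorem isClosed_conj_smul₄ {A : Subgroup P} (hA : IsClosed (A : Set P)) (γ : ConjAct P) :
    IsClosed ((γ • A : Subgroup P) : Set P) := by
  have h : ((γ • A : Subgroup P) : Set P) = (fun x : P => γ⁻¹ • x) ⁻¹' (A : Set P) := by
    ext x
    rw [SetLike.mem_coe, Subgroup.mem_pointwise_smul_iff_inv_smul_mem]
    rfl
  rw [h]
  refine hA.preimage ?_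
  simp only [ConjAct.smul_def]
  fun_prop

omit [CompactSpace P] [T2Space P] [TotallyDisconnectedSpace P] in
/-- A homomorphism with closed kernel killing `z ∈ Γ` kills every conjugate of `cl ι⟨z⟩`.
[cite: MochizukiCombGC2007, Prop 1.2(i) p.8] -/
theorem smul_map_zpowers_closure_le_ker_of_isClosed {Γ : Type*} [Group Γ] (ι : Γ →* P)
    {Q : Type*} [Group Q] (Ψ : P →* Q) (hk : IsClosed (Ψ.ker : Set P)) (z : Γ) (hz : Ψ (ι z) = 1)
    (δ : ConjAct P) : δ • ((Subgroup.zpowers z).map ι).topologicalClosure ≤ Ψ.ker :=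
  smul_le_ker_of_le_ker (Subgroup.topologicalClosure_minimal _
    (Subgroup.map_le_iff_le_comap.mpr ((Subgroup.zpowers_le).mpr (by simpa using hz))) hk) δ

omit [T2Space P] in
/-- **The Heisenberg engine** (public form of the engines of `PSCTwoComponentAffinePointedEdges.lean` /
`PSCTwoComponentUnmarkedEdges.lean`): `ι : Γ_{g,r} → Π` a pro-`Σ` completion, `ℓ ∈ Σ` prime,
`γ₁ι(γ₀)γ₁⁻¹ ∈ S`; if for every `n` and every Heisenberg triple `X, Y, Z = [X,Y]` (`Z` central) of
`H = (ℤ/ℓⁿ × ℤ/ℓⁿ) ⋊ ℤ/ℓⁿ` some `ψ : Γ_{g,r} → H` sends `γ₀` to `Z^{±1}` and all its closed-kernel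
extensions to `Π` kill `T`, then `S ∩ T` is not open in `S`: a positive power `m` of `γ₁ι(γ₀)γ₁⁻¹` would lie
in `T` (`exists_pow_mem_of_isOpen_inf_subgroupOf`), forcing `Z^m = 1`, i.e. `ℓ^m ∣ m`.
[cite: MochizukiCombGC2007, Prop 1.2(i) p.8] -/
theorem not_isOpen_inf_subgroupOf_of_heisenberg {ι : PuncturedSurfaceGroup g r →* P}
    (hι : IsProSigmaCompletion Sigma ι) {ℓ : ℕ} (hℓ : ℓ.Prime) (hℓS : ℓ ∈ Sigma) {S T : Subgroup P}
    (γ₁ : ConjAct P) (γ₀ : PuncturedSurfaceGroup g r) (hx : γ₁ • ι γ₀ ∈ S)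
    (h : ∀ (n : ℕ) (φ : Multiplicative (ZMod (ℓ ^ n)) →* MulAut (Multiplicative (ZMod (ℓ ^ n) × ZMod (ℓ ^ n))))
      (X Y Z : Multiplicative (ZMod (ℓ ^ n) × ZMod (ℓ ^ n)) ⋊[φ] Multiplicative (ZMod (ℓ ^ n))), X * Y * X⁻¹ * Y⁻¹ = Z → Z ∈ Subgroup.center (Multiplicative (ZMod (ℓ ^ n) × ZMod (ℓ ^ n)) ⋊[φ] Multiplicative (ZMod (ℓ ^ n))) →
      ∃ ψ : PuncturedSurfaceGroup g r →* Multiplicative (ZMod (ℓ ^ n) × ZMod (ℓ ^ n)) ⋊[φ] Multiplicative (ZMod (ℓ ^ n)), (ψ γ₀ = Z ∨ ψ γ₀ = Z⁻¹) ∧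
        ∀ Ψ : P →* Multiplicative (ZMod (ℓ ^ n) × ZMod (ℓ ^ n)) ⋊[φ] Multiplicative (ZMod (ℓ ^ n)), IsClosed (Ψ.ker : Set P) → (∀ γ, Ψ (ι γ) = ψ γ) → T ≤ Ψ.ker) :
    ¬ IsOpen (((S ⊓ T).subgroupOf S : Subgroup S) : Set S) := by
  intro hopen
  obtain ⟨n, hn, hxn⟩ := exists_pow_mem_of_isOpen_inf_subgroupOf hx hopen
  obtain ⟨φ, X, Y, Z, hXY, hZc, hZ, hcard⟩ := Heisenberg.exists_heisenbergTriple_central (ℓ ^ n)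
  obtain ⟨ψ, hψ, hT⟩ := h n φ X Y Z hXY hZc
  letI : TopologicalSpace (Multiplicative (ZMod (ℓ ^ n) × ZMod (ℓ ^ n)) ⋊[φ] Multiplicative (ZMod (ℓ ^ n))) := ⊥
  haveI : DiscreteTopology (Multiplicative (ZMod (ℓ ^ n) × ZMod (ℓ ^ n)) ⋊[φ] Multiplicative (ZMod (ℓ ^ n))) := ⟨rfl⟩
  haveI : Finite (Multiplicative (ZMod (ℓ ^ n) × ZMod (ℓ ^ n)) ⋊[φ] Multiplicative (ZMod (ℓ ^ n))) :=
    Nat.finite_of_card_ne_zero (by rw [hcard]; exact pow_ne_zero _ (pow_ne_zero _ hℓ.ne_zero))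
  obtain ⟨Ψ, hΨc, hΨ⟩ := hι.exists_continuous_extend_of_card_primePow hℓ hℓS (k := n * 3)
    (by rw [hcard, pow_mul]) ψ
  have hk : IsClosed (Ψ.ker : Set P) := by
    rw [MonoidHom.coe_ker]
    exact (isClosed_discrete _).preimage hΨc
  have h1 : Ψ ((γ₁ • ι γ₀) ^ n) = 1 := hT Ψ hk hΨ hxn
  rw [map_pow, ConjAct.smul_def, map_mul, map_mul, map_inv, conj_pow, conj_eq_one_iff, hΨ] at h1
  have hdvd : ℓ ^ n ∣ n := by
    rcases hψ with hψ | hψ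
    · exact (hZ n).mp (hψ ▸ h1)
    · rw [hψ, inv_pow, inv_eq_one] at h1
      exact (hZ n).mp h1
  exact absurd (Nat.le_of_dvd hn hdvd) (not_le.mpr (Nat.lt_pow_self hℓ.one_lt))

/-! ### The edge-like case at irreducible one-nodal shape -/

/-- **[CombGC] Prop. 1.2 (i), edge-like case, at irreducible one-nodal shape** (node group
`closure ι⟨b_0⟩`, cusp groups `closure ι⟨c_j⟩`, `2 ≤ g ∨ 2 ≤ r`): node/node — one node; cusp/cusp —
malnormality; node/cusp — the handle character `b_0 ↦ 1`; cusp/node — the two-cusp character, or for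
`r = 1` the Heisenberg quotient on the handle `1`. [cite: MochizukiCombGC2007, Prop 1.2(i) p.8] -/
theorem edgeLikeOpenInterDeterminesEdge_of_irreducibleNodal (hne : Sigma.Nonempty)
    (hprime : ∀ p ∈ Sigma, p.Prime) (ι : PuncturedSurfaceGroup g r →* P)
    (hι : IsProSigmaCompletion Sigma ι) (G : PSCDatum P) (hg : 1 ≤ g) (hgr : 2 ≤ g ∨ 2 ≤ r)
    (e : G.graph.C ≃ Fin r)
    (hC : ∀ c, G.cuspGp c =
      ((PuncturedSurfaceGroup.cuspInertia (g := g) (e c)).map ι).topologicalClosure)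
    (n₀ : G.graph.N) (hN : ∀ n, n = n₀)
    (hE : G.nodeGp n₀ =
      ((Subgroup.zpowers (PuncturedSurfaceGroup.b (r := r) (⟨0, hg⟩ : Fin g))).map ι).topologicalClosure) :
    G.EdgeLikeOpenInterDeterminesEdge := by
  classical
  have hne' := hne
  obtain ⟨ℓ, hℓS⟩ := hne
  have hℓ : ℓ.Prime := hprime ℓ hℓS
  have hhyp : PuncturedSurfaceGroup.IsHyperbolicType g r := by
    unfold PuncturedSurfaceGroup.IsHyperbolicType; omega
  intro e₁ e₂ γ₁ γ₂ hopen
  by_contra hne12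
  rcases e₁ with n₁ | c₁ <;> rcases e₂ with n₂ | c₂
  · exact hne12 (by rw [hN n₁, hN n₂])
  · -- node vs cusp: the handle character `b_0 ↦ 1`
    have hopen' := hopen
    change IsOpen ((((γ₁ • G.nodeGp n₁) ⊓ γ₂ • G.cuspGp c₂).subgroupOf (γ₁ • G.nodeGp n₁) :
      Subgroup (γ₁ • G.nodeGp n₁ : Subgroup P)) : Set (γ₁ • G.nodeGp n₁ : Subgroup P)) at hopen'
    rw [hN n₁, hE, hC, PuncturedSurfaceGroup.cuspInertia] at hopen'
    refine not_isOpen_inf_subgroupOf_of_characters hℓ.one_lt _ _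
      (x := γ₁ • ι (PuncturedSurfaceGroup.b (r := r) (⟨0, hg⟩ : Fin g)))
      (Subgroup.smul_mem_pointwise_smul _ _ _ (Subgroup.le_topologicalClosure _
        (Subgroup.mem_map_of_mem ι (Subgroup.mem_zpowers _)))) (fun n => ?_) hopen'
    let wb : Fin g → ZMod (ℓ ^ n) := fun i => if i = ⟨0, hg⟩ then 1 else 0
    obtain ⟨φ, -, hφb, hφc⟩ :=
      PuncturedSurfaceGroup.exists_handleCuspCharacter (r := r) 0 wb 0 (by simp)
    obtain ⟨χ, hχc, hχ⟩ := exists_continuous_extend_zmod_pow hι hℓ hℓS n φ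
    refine ⟨χ, smul_le_ker_of_le_ker (topologicalClosure_map_zpowers_le_ker ι χ hχc _ ?_) γ₂,
      by rw [map_conjAct_smul_eq_self, hχ, hφb]; simp [wb]⟩
    rw [hχ, hφc]; rfl
  · -- cusp `j = e c₁` vs node
    by_cases hk : ∃ k : Fin r, k ≠ e c₁
    · -- abelian: `δ_j − δ_k` (kills `b_0`)
      obtain ⟨k, hkj⟩ := hk
      have hopen' := hopen
      change IsOpen ((((γ₁ • G.cuspGp c₁) ⊓ γ₂ • G.nodeGp n₂).subgroupOf (γ₁ • G.cuspGp c₁) :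
        Subgroup (γ₁ • G.cuspGp c₁ : Subgroup P)) : Set (γ₁ • G.cuspGp c₁ : Subgroup P)) at hopen'
      rw [hN n₂, hE, hC, PuncturedSurfaceGroup.cuspInertia] at hopen'
      refine not_isOpen_inf_subgroupOf_of_characters hℓ.one_lt _ _
        (x := γ₁ • ι (PuncturedSurfaceGroup.c (e c₁)))
        (Subgroup.smul_mem_pointwise_smul _ _ _ (Subgroup.le_topologicalClosure _
          (Subgroup.mem_map_of_mem ι (Subgroup.mem_zpowers _)))) (fun n => ?_) hopen'
      let wc : Fin r → ZMod (ℓ ^ n) := fun l =>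
        (if l = e c₁ then 1 else 0) + (if l = k then -1 else 0)
      obtain ⟨φ, -, hφb, hφc⟩ :=
        PuncturedSurfaceGroup.exists_handleCuspCharacter (g := g) 0 0 wc (sum_twoDelta (e c₁) k)
      obtain ⟨χ, hχc, hχ⟩ := exists_continuous_extend_zmod_pow hι hℓ hℓS n φ
      refine ⟨χ, smul_le_ker_of_le_ker (topologicalClosure_map_zpowers_le_ker ι χ hχc _ ?_) γ₂,
        by rw [map_conjAct_smul_eq_self, hχ, hφc]; simp [wc, hkj.symm]⟩
      rw [hχ, hφb]; rfl
    · -- `r = 1`, so `g ≥ 2`: Heisenberg on the handle `1`, `c_j ↦ Z⁻¹`, `b_0 ↦ 1`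
      have hg2 : 2 ≤ g := by
        rcases hgr with h | h
        · exact h
        · exfalso
          refine hk ?_
          by_cases h0 : ((e c₁ : Fin r) : ℕ) = 0
          · exact ⟨⟨1, by omega⟩, fun h' => absurd (congrArg Fin.val h') (by simp; omega)⟩
          · exact ⟨⟨0, by omega⟩, fun h' => absurd (congrArg Fin.val h') (by simp; omega)⟩
      refine not_isOpen_inf_subgroupOf_of_heisenberg hι hℓ hℓS (S := γ₁ • G.edgeGp (Sum.inr c₁))
        (T := γ₂ • G.edgeGp (Sum.inl n₂)) γ₁ (PuncturedSurfaceGroup.c (e c₁)) ?_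
        (fun n φ X Y Z hXY _ => ?_) hopen
      · change γ₁ • ι (PuncturedSurfaceGroup.c (e c₁)) ∈ γ₁ • G.cuspGp c₁
        rw [hC]
        exact Subgroup.smul_mem_pointwise_smul _ _ _ (Subgroup.le_topologicalClosure _
          (Subgroup.mem_map_of_mem ι (Subgroup.mem_zpowers _)))
      · have hrel : X * Y * X⁻¹ * Y⁻¹ * Z⁻¹ = 1 := by rw [hXY, mul_inv_cancel]
        obtain ⟨ψ, -, -, hc, hab', -⟩ := PuncturedSurfaceGroup.exists_hom_handle_cusp
          (g := g) (r := r) ⟨1, by omega⟩ (e c₁) X Y Z⁻¹ hrel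
        refine ⟨ψ, Or.inr hc, fun Ψ hΨc hΨ => ?_⟩
        change γ₂ • G.nodeGp n₂ ≤ Ψ.ker
        rw [hN n₂, hE]
        refine smul_map_zpowers_closure_le_ker_of_isClosed ι Ψ hΨc _ ?_ γ₂
        rw [hΨ, (hab' ⟨0, hg⟩ (fun h' => absurd (congrArg Fin.val h') (by simp))).2]
  · -- cusp vs cusp: malnormality of cusp inertia
    by_cases hc : c₁ = c₂
    · exact hne12 (by rw [hc])
    have hopen' := hopen
    change IsOpen ((((γ₁ • G.cuspGp c₁) ⊓ (γ₂ • G.cuspGp c₂)).subgroupOf (γ₁ • G.cuspGp c₁) :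
      Subgroup (γ₁ • G.cuspGp c₁ : Subgroup P)) : Set (γ₁ • G.cuspGp c₁ : Subgroup P)) at hopen'
    rw [G.smul_cuspGp_inf_smul_cuspGp_eq_bot hne' hprime hhyp ι hι e hC hc, Subgroup.bot_subgroupOf,
      Subgroup.coe_bot] at hopen'
    haveI : DiscreteTopology (γ₁ • G.cuspGp c₁ : Subgroup P) :=
      discreteTopology_iff_isOpen_singleton_one.mpr hopen'
    haveI : CompactSpace (γ₁ • G.cuspGp c₁ : Subgroup P) :=
      isCompact_iff_compactSpace.mp (isClosed_conj_smul₄ (G.isClosed_cuspGp c₁) γ₁).isCompact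
    haveI := G.infinite_cuspGp hne' hprime hhyp ι hι e hC c₁
    haveI : Infinite (γ₁ • G.cuspGp c₁ : Subgroup P) :=
      Infinite.of_injective _ (Subgroup.equivSMul γ₁ (G.cuspGp c₁)).injective
    exact (‹Infinite (γ₁ • G.cuspGp c₁ : Subgroup P)›).not_finite finite_of_compact_of_discrete

/-- **[CombGC] Prop. 1.2 (i) — all three cases — at every datum of irreducible one-nodal shape** (one
vertex: the verticial and unramified cases are trivial, abc-iut-L3-t4's `…_of_subsingleton`).
[cite: MochizukiCombGC2007, Prop 1.2(i) p.8] -/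
theorem openInterDeterminesComponent_of_irreducibleNodal (hne : Sigma.Nonempty)
    (hprime : ∀ p ∈ Sigma, p.Prime) (ι : PuncturedSurfaceGroup g r →* P)
    (hι : IsProSigmaCompletion Sigma ι) (G : PSCDatum P) (hg : 1 ≤ g) (hgr : 2 ≤ g ∨ 2 ≤ r)
    (e : G.graph.C ≃ Fin r)
    (hC : ∀ c, G.cuspGp c =
      ((PuncturedSurfaceGroup.cuspInertia (g := g) (e c)).map ι).topologicalClosure)
    (v₀ : G.graph.V) (hV : ∀ w, w = v₀) (n₀ : G.graph.N) (hN : ∀ n, n = n₀)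
    (hE : G.nodeGp n₀ =
      ((Subgroup.zpowers (PuncturedSurfaceGroup.b (r := r) (⟨0, hg⟩ : Fin g))).map ι).topologicalClosure) :
    G.VerticialOpenInterDeterminesVertex ∧ G.EdgeLikeOpenInterDeterminesEdge ∧
      G.UnrVerticialOpenInterDeterminesVertex :=
  ⟨G.verticialOpenInterDeterminesVertex_of_subsingleton v₀ hV,
    G.edgeLikeOpenInterDeterminesEdge_of_irreducibleNodal hne hprime ι hι hg hgr e hC n₀ hN hE,
    G.unrVerticialOpenInterDeterminesVertex_of_subsingleton v₀ hV⟩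

end PSCDatum

end Literature.AnabelianGeometry.SemiGraphs

end
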